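import Mathlib
import Summits.CriticalPhenomena.CardyFormulaZ2.Theorems.CardyFlipRussoSquareFromVoronoiHubDefs
import Literature.Probability.Percolation.SitePaths
import Literature.Probability.Percolation.VoronoiCrossing

/-!
# Stub `stub_faithful` (K1), line `Sketch` of crux `SquareFromVoronoiHub` — Part 4:
# glue between the continuum events and the lattice lemmas

Crux `Summit.CriticalPhenomena.CardyFormulaZ2.Theses.CardyFlipRusso.SquareFromVoronoiHub`
(stmt-CriticalPhenomena-6434), line `Sketch` (card `voronoi-blocks-on-fixed-gs`), stub
`stub_faithful` (K1); registered sub-goal `stub_faithful_part4`.  Three deterministic glue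
lemmas around Parts 1–3 (no probability):

* `exists_mem_closure_of_split` (**the topological input `hcl` of Part 2's robust-path lemma**):
  if every point of a path off `closure Ω` lies in one of two disjoint closed sets `F₀`, `F₂`
  with `F₀` at distance `> δ` from `(cd)` and `F₂` at distance `> δ` from `(ab)` (in the
  application: the `o(1)`-neighbourhoods of the two exterior caps beyond `(ab)` and `(cd)` of the
  perturbed rectangle), then no sub-path gets from within `δ` of `(ab)` to within `δ` of `(cd)`
  while avoiding `closure Ω` (a connected set inside `F₀ ∪ F₂` lies in one of them);
* `exists_path_of_voronoiCrossing`: the continuum event `voronoiCrossing Ω (ab) (cd) ε B W`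
  unpacked into path data — a path from a point of `(ab)` to a point of `(cd)` all of whose
  points lie in `closure Ω` and in the black region of the nuclei dilated by `ε` (the shape
  consumed by Part 2's `blockConfig_mem_crudeCrossing_of_path`);
* `joinedIn_of_pathIn` (**lattice path ⇒ continuum path**, the easy direction of step (1)(a)):
  if every two ADJACENT sites of a set `A` are joined inside `K`, then every `G`-path inside `A`
  gives a continuum path inside `K` between the positions of its endpoints (induction along the
  path, `JoinedIn.trans`); for the block colouring, `A` = black sites of the window and the
  pairwise joins come from the absence of sub-mesh Voronoi defects (Parts ≥ 5).
-/

noncomputable section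

namespace Summit.CriticalPhenomena.CardyFormulaZ2.Cruxes.SquareFromVoronoiHub.VoronoiBlocks.Faithful

open scoped Pointwise Topology
open Set Metric Filter
open Literature.Probability.Percolation (SiteConfig siteConnIn PathIn blackRegion voronoiCrossing
  voronoiCrossing_iff_smul)
open Literature.Probability.RandomPlanarGeometry (ConformalRectangle)
open Literature.Analysis.FunctionSpaces (PointConfig)

/-! ### The topological input `hcl` from a splitting of the off-`closure Ω` part -/

/-- **`hcl` from a splitting.**  Let `γ` be a path such that every point of `γ` off `closure Ω`
lies in `F₀ ∪ F₂`, where `F₀`, `F₂` are disjoint closed sets, `F₀` at distance `> δ` from the arc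
`(cd) = R.arc 2` and `F₂` at distance `> δ` from `(ab) = R.arc 0`.  Then every sub-path of `γ`
from within `δ` of `(ab)` to within `δ` of `(cd)` meets `closure Ω` (else its connected image lies
in `F₀` or in `F₂`, contradicting one of the endpoint conditions). [folklore] -/
theorem exists_mem_closure_of_split (R : ConformalRectangle) {δ : ℝ} {x y : ℂ} (γ : Path x y)
    {F₀ F₂ : Set ℂ} (hF₀ : IsClosed F₀) (hF₂ : IsClosed F₂) (hdisj : Disjoint F₀ F₂)
    (hout : ∀ t, γ t ∉ closure R.carrier → γ t ∈ F₀ ∪ F₂)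
    (h₀ : ∀ z ∈ F₀, δ < infDist z (R.arc 2)) (h₂ : ∀ z ∈ F₂, δ < infDist z (R.arc 0))
    (t₁ t₂ : unitInterval) (ht : t₁ ≤ t₂) (h1 : infDist (γ t₁) (R.arc 0) ≤ δ)
    (h2 : infDist (γ t₂) (R.arc 2) ≤ δ) :
    ∃ u : unitInterval, t₁ ≤ u ∧ u ≤ t₂ ∧ γ u ∈ closure R.carrier := by
  by_contra hcon
  push Not at hcon
  -- the image of `[t₁, t₂]` is connected and lies in `F₀ ∪ F₂`
  have hsub : γ '' Icc t₁ t₂ ⊆ F₀ ∪ F₂ := by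
    rintro _ ⟨u, hu, rfl⟩
    exact hout u (hcon u hu.1 hu.2)
  have hpre : IsPreconnected (γ '' Icc t₁ t₂) :=
    isPreconnected_Icc.image _ γ.continuous.continuousOn
  have hempty : γ '' Icc t₁ t₂ ∩ (F₀ ∩ F₂) = ∅ := by
    rw [hdisj.inter_eq, inter_empty]
  rcases (isPreconnected_iff_subset_of_disjoint_closed.1 hpre) F₀ F₂ hF₀ hF₂ hsub hempty with h | h
  · exact (h₀ _ (h ⟨t₂, ⟨ht, le_rfl⟩, rfl⟩)).not_ge h2
  · exact (h₂ _ (h ⟨t₁, ⟨le_rfl, ht⟩, rfl⟩)).not_ge h1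

/-! ### The continuum event as path data -/

/-- **The continuum Voronoi crossing as a path.**  At a scale `ε ≠ 0`, the event
`voronoiCrossing Ω (ab) (cd) ε B W` yields a path from a point of `(ab)` to a point of `(cd)` all
of whose points lie in `closure Ω` and in the black region of the dilated nuclei `ε • B`, `ε • W`
(`voronoiCrossing_iff_smul`, `JoinedIn.somePath`). [folklore] -/
theorem exists_path_of_voronoiCrossing {Ω A A' : Set ℂ} {ε : ℝ} (hε : ε ≠ 0) {B W : Set ℂ}
    (h : voronoiCrossing Ω A A' ε B W) :
    ∃ (x y : ℂ) (γ : Path x y), x ∈ A ∧ y ∈ A' ∧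
      ∀ t, γ t ∈ closure Ω ∧ γ t ∈ blackRegion ((ε : ℂ) • B) ((ε : ℂ) • W) := by
  rw [voronoiCrossing_iff_smul hε] at h
  obtain ⟨x, hx, y, hy, hJ⟩ := h
  exact ⟨x, y, hJ.somePath, hx, hy, fun t => hJ.somePath_mem t⟩

/-- The same for a pair of point configurations read at scale `ε` on a conformal rectangle: the
shape of the event inside `voronoiCrossingProb`. [folklore] -/
theorem exists_path_of_voronoiCrossing_conformalRectangle (R : ConformalRectangle) {ε : ℝ}
    (hε : ε ≠ 0) (c : PointConfig ℂ × PointConfig ℂ)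
    (h : voronoiCrossing R.carrier (R.arc 0) (R.arc 2) ε (c.1 : Set ℂ) (c.2 : Set ℂ)) :
    ∃ (x y : ℂ) (γ : Path x y), x ∈ R.arc 0 ∧ y ∈ R.arc 2 ∧
      ∀ t, γ t ∈ closure R.carrier ∧
        γ t ∈ blackRegion ((ε : ℂ) • (c.1 : Set ℂ)) ((ε : ℂ) • (c.2 : Set ℂ)) :=
  exists_path_of_voronoiCrossing hε h

/-! ### Lattice path ⇒ continuum path -/

/-- **Lattice path ⇒ continuum path.**  If every two `G`-adjacent sites of `A` have positions
joined inside `K`, and the position of every site of `A` lies in `K`, then a `G`-path inside `A`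
from `u` to `w` gives a continuum path inside `K` from the position of `u` to that of `w`
(induction along the path). [folklore] -/
theorem joinedIn_of_pathIn {V : Type*} {G : SimpleGraph V} {A : Set V} {K : Set ℂ} (pos : V → ℂ)
    (hmem : ∀ v ∈ A, pos v ∈ K)
    (hadj : ∀ v ∈ A, ∀ v' ∈ A, G.Adj v v' → JoinedIn K (pos v) (pos v'))
    {u w : V} (h : PathIn G A u w) : JoinedIn K (pos u) (pos w) := by
  obtain ⟨hu, h⟩ := h
  induction h with
  | refl => exact JoinedIn.refl (hmem u hu)
  | @tail b c hub hbc ih =>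
    have hb : b ∈ A := (show PathIn G A u b from ⟨hu, hub⟩).right_mem
    exact ih.trans (hadj b hb c hbc.2 hbc.1)

/-- **Open lattice crossing ⇒ continuum path**, read for the crux's crude event: if
`ω ∈ crudeCrossing R δ` and every two `G_s`-adjacent open sites inside `Ω` have positions joined
inside `K` (which contains the positions of all open sites inside `Ω`), then `K` contains a
continuum path from within `2δ` of `(ab)` to within `2δ` of `(cd)`.  For the block colouring,
`K` = an `o(1)`-neighbourhood of `closure Ω` intersected with the black region, the joins coming
from the absence of sub-mesh Voronoi defects. [folklore] -/
theorem exists_joinedIn_of_mem_crudeCrossing (R : ConformalRectangle) {δ : ℝ}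
    {ω : SiteConfig ((ℤ × ℤ) ⊕ (ℤ × ℤ))} (h : ω ∈ crudeCrossing R δ) {K : Set ℂ}
    (hmem : ∀ v ∈ ω, (δ : ℂ) * zGs v ∈ R.carrier → (δ : ℂ) * zGs v ∈ K)
    (hadj : ∀ v ∈ ω, ∀ v' ∈ ω, (δ : ℂ) * zGs v ∈ R.carrier → (δ : ℂ) * zGs v' ∈ R.carrier →
      Gs.Adj v v' → JoinedIn K ((δ : ℂ) * zGs v) ((δ : ℂ) * zGs v')) :
    ∃ p q : ℂ, infDist p (R.arc 0) ≤ 2 * δ ∧ infDist q (R.arc 2) ≤ 2 * δ ∧ JoinedIn K p q := by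
  obtain ⟨u, w, hu, hw, hconn⟩ := h
  have hpath := Literature.Probability.Percolation.PathIn.of_mem_siteConnIn hconn
  refine ⟨_, _, hu, hw, joinedIn_of_pathIn (fun v => (δ : ℂ) * zGs v) ?_ ?_ hpath⟩
  · rintro v ⟨hvΩ, hvω⟩
    exact hmem v hvω hvΩ
  · rintro v ⟨hvΩ, hvω⟩ v' ⟨hv'Ω, hv'ω⟩ hvv'
    exact hadj v hvω v' hv'ω hvΩ hv'Ω hvv'

/-- **Registered sub-goal `stub_faithful_part4`** of `stub_faithful` (K1): the topological input
`hcl` of Part 2's robust-path lemma from a splitting of the off-`closure Ω` part of the path into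
two disjoint closed pieces, far from `(cd)` and from `(ab)` respectively. [folklore] -/
theorem stub_faithful_part4 : ∀ (R : ConformalRectangle) {δ : ℝ} {x y : ℂ} (γ : Path x y) {F₀ F₂ : Set ℂ}, IsClosed F₀ → IsClosed F₂ → Disjoint F₀ F₂ → (∀ t, γ t ∉ closure R.carrier → γ t ∈ F₀ ∪ F₂) → (∀ z ∈ F₀, δ < Metric.infDist z (R.arc 2)) → (∀ z ∈ F₂, δ < Metric.infDist z (R.arc 0)) → ∀ t₁ t₂ : unitInterval, t₁ ≤ t₂ → Metric.infDist (γ t₁) (R.arc 0) ≤ δ → Metric.infDist (γ t₂) (R.arc 2) ≤ δ → ∃ u : unitInterval, t₁ ≤ u ∧ u ≤ t₂ ∧ γ u ∈ closure R.carrier :=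
  fun R _ _ _ γ _ _ hF₀ hF₂ hdisj hout h₀ h₂ t₁ t₂ ht h1 h2 =>
    exists_mem_closure_of_split R γ hF₀ hF₂ hdisj hout h₀ h₂ t₁ t₂ ht h1 h2

end Summit.CriticalPhenomena.CardyFormulaZ2.Cruxes.SquareFromVoronoiHub.VoronoiBlocks.Faithful

end
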